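import Mathlib
import HarnessLib
import Summits.HubbardSuperconductivity.HubbardSuperconductivity.Theorems.KLProgrammeSalmhoferCutoffDerivTableRecord
import Summits.HubbardSuperconductivity.HubbardSuperconductivity.Theorems.KLProgrammeSmoothTransitionCauchySharp

/-!
# Route `KLProgramme` — engine support (cell gate-hubbard-kl, #22a (2e) «sharp χ₂ table», seat p2 g18): derivative table record of `χ₂`,
# VERSION 2 — the proved rows sharpened by the three-arc cover (`…SmoothTransitionCauchySharp`)

`klChi2CauchyTab2`: the PROVED numeral table of `sup_x ‖Dⁿχ₂(x)‖` (`χ₂ = salmhoferCutoff = smoothTransition((4·−1)/3)`), version 2: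
`n ≤ 2` the tree's sharp `1, 8/3, 176/9`; `n = 3, 4, 5` the cover rows `2952, 65550, 2334000`; `6 ≤ n ≤ 16` the 4-digit ceilings of the
ONE-TERM table `(4/3)ⁿ·5·n!·(199n/99)ⁿ·e^{−n}`; `n ≥ 17` the Gevrey numerals `8·(n!)²·342ⁿ`.  Against version 1 (`klChi2CauchyTab`,
`…SalmhoferCutoffDerivTableRecord`): rows `3–9` shrink by `4.3, 7.8, 11.0, 10.3, 6.4, 3.7, 2.2`, rows `≥ 10` by `≤ 1.5`; against the kit-certified
truth (`klChi2CertTab`, j305013) the proved rows are now within `11.3, 9.1, 7.2, 5.7, 5.9, 6.3, 6.9, 7.7, 8.2, 8.2, 8.5, 8.9, 9.5, 10.3` (`n = 3…16`).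
* **`norm_iteratedFDeriv_salmhoferCutoff_le_klChi2CauchyTab2`** (every `n`, every `x`); `klChi2CauchyTab2_le_klChi2CauchyTab` (v2 ≤ v1),
  `klChi2CertTab_le_klChi2CauchyTab2` (certified ≤ proved v2), `one_le_klChi2CauchyTab2`, `klChi2CauchyTab2_mono`,
  `salmhoferCutoff_flat_cauchy_table2` / `…_deriv` (the flat shape `∀ i ≤ n, ‖Dⁱχ₂‖ ≤ klChi2CauchyTab2 n` of the scale-0 symbol lemmas).
Nothing here concerns the model.  References: Salmhofer 1999 §4.2.5 (4.71); [cite: BenfattoGiulianiMastropietro2006] §2.2 (2.9); Krantz–Parks 2002 Prop. 2.2.10.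
-/

noncomputable section

namespace Summit.HubbardSuperconductivity.HubbardSuperconductivity.Theorems.KLRegimeSplit

set_option linter.dupNamespace false -- summit = problem name (single-conjunct summit), D-0017

open Literature.MathematicalPhysics.QuantumLattice
open scoped Nat

/-- The PROVED numeral table of `sup‖Dⁿχ₂‖`, version 2 (three-arc cover for `3 ≤ n`; see the module doc). [cite: BenfattoGiulianiMastropietro2006, §2.2 (2.9)] -/
def klChi2CauchyTab2 (n : ℕ) : ℝ :=
  if n = 0 then 1 else if n = 1 then 8 / 3 else if n = 2 then 176 / 9 else if n = 3 then 2952 else if n = 4 then 65550 else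
  if n = 5 then 2334000 else if n = 6 then 154400000 else if n = 7 then 18800000000 else if n = 8 then 3021000000000 else
  if n = 9 then 619000000000000 else if n = 10 then 157600000000000000 else if n = 11 then 48750000000000000000 else
  if n = 12 then 18030000000000000000000 else if n = 13 then 7848000000000000000000000 else
  if n = 14 then 3975000000000000000000000000 else if n = 15 then 2317000000000000000000000000000 else
  if n = 16 then 1540000000000000000000000000000000 else 8 * ((n ! : ℝ)) ^ 2 * 342 ^ n

/-- **Every row of the version-2 table holds**: `‖iteratedFDeriv ℝ n χ₂ x‖ ≤ klChi2CauchyTab2 n` for all `n`, `x`.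
[cite: BenfattoGiulianiMastropietro2006, §2.2 (2.9)] -/
theorem norm_iteratedFDeriv_salmhoferCutoff_le_klChi2CauchyTab2 (n : ℕ) (x : ℝ) :
    ‖iteratedFDeriv ℝ n salmhoferCutoff x‖ ≤ klChi2CauchyTab2 n := by
  by_cases h2 : n ≤ 2
  · refine (norm_iteratedFDeriv_salmhoferCutoff_le_klChi2CauchyTab n x).trans (le_of_eq ?_)
    interval_cases n <;> simp [klChi2CauchyTab, klChi2CauchyTab2]
  by_cases h5 : n ≤ 5
  · have h := norm_iteratedFDeriv_salmhoferCutoff_le_row_three_four_five (n := n) (by omega) h5 x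
    interval_cases n <;> simp only [klChi2CauchyTab2] <;> norm_num at h ⊢ <;> exact h
  by_cases h16 : n ≤ 16
  · refine (norm_iteratedFDeriv_salmhoferCutoff_le_cauchy_sharp_rat (n := n) (by omega) x).trans ?_
    interval_cases n <;> simp only [klChi2CauchyTab2] <;> norm_num [Nat.factorial]
  · rw [not_le] at h16
    refine (norm_iteratedFDeriv_salmhoferCutoff_le_gevrey n x).trans (le_of_eq ?_)
    simp only [klChi2CauchyTab2]
    repeat rw [if_neg (by omega)]

/-- Version 2 is below version 1, row by row. [cite: BenfattoGiulianiMastropietro2006, §2.2 (2.9)] -/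
theorem klChi2CauchyTab2_le_klChi2CauchyTab (n : ℕ) : klChi2CauchyTab2 n ≤ klChi2CauchyTab n := by
  by_cases h16 : n ≤ 16
  · interval_cases n <;> simp only [klChi2CauchyTab2, klChi2CauchyTab] <;> norm_num
  · simp only [klChi2CauchyTab2, klChi2CauchyTab]
    repeat rw [if_neg (by omega)]

/-- The kit-certified rows are below the proved version-2 rows (ratios proved/certified `n = 3…16`: 11.3, 9.1, 7.2, 5.7, 5.9, 6.3, 6.9, 7.7, 8.2, 8.2, 8.5, 8.9, 9.5, 10.3).
[cite: BenfattoGiulianiMastropietro2006, §2.2 (2.9)] -/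
theorem klChi2CertTab_le_klChi2CauchyTab2 (n : ℕ) : klChi2CertTab n ≤ klChi2CauchyTab2 n := by
  by_cases h16 : n ≤ 16
  · interval_cases n <;> simp only [klChi2CertTab, klChi2CauchyTab2] <;> norm_num
  · simp only [klChi2CertTab, klChi2CauchyTab2]
    repeat rw [if_neg (by omega)]

/-- `1 ≤ klChi2CauchyTab2 n`. [cite: BenfattoGiulianiMastropietro2006, §2.2 (2.9)] -/
theorem one_le_klChi2CauchyTab2 (n : ℕ) : 1 ≤ klChi2CauchyTab2 n := by
  by_cases h16 : n ≤ 16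
  · interval_cases n <;> simp only [klChi2CauchyTab2] <;> norm_num
  · simp only [klChi2CauchyTab2]
    repeat rw [if_neg (by omega)]
    have h1 : (1 : ℝ) ≤ (n ! : ℝ) := by exact_mod_cast Nat.one_le_iff_ne_zero.2 (Nat.factorial_ne_zero n)
    have h2 : (1 : ℝ) ≤ (342 : ℝ) ^ n := one_le_pow₀ (by norm_num)
    nlinarith

/-- Row `n ≤` row `n+1` (version 2). [cite: BenfattoGiulianiMastropietro2006, §2.2 (2.9)] -/
theorem klChi2CauchyTab2_le_succ (n : ℕ) : klChi2CauchyTab2 n ≤ klChi2CauchyTab2 (n + 1) := by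
  by_cases h16 : n ≤ 16
  · interval_cases n <;> simp only [klChi2CauchyTab2] <;> norm_num [Nat.factorial]
  · rw [not_le] at h16
    simp only [klChi2CauchyTab2]
    repeat rw [if_neg (by omega)]
    have hf : ((n ! : ℕ) : ℝ) ≤ (((n + 1) ! : ℕ) : ℝ) := by exact_mod_cast Nat.factorial_le (Nat.le_succ n)
    have hf0 : (0 : ℝ) ≤ ((n ! : ℕ) : ℝ) := by positivity
    have h2 : ((n ! : ℕ) : ℝ) ^ 2 ≤ (((n + 1) ! : ℕ) : ℝ) ^ 2 := pow_le_pow_left₀ hf0 hf 2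
    have hp : (342 : ℝ) ^ n ≤ 342 ^ (n + 1) := pow_le_pow_right₀ (by norm_num) (Nat.le_succ n)
    calc (8 : ℝ) * ((n ! : ℕ) : ℝ) ^ 2 * 342 ^ n ≤ 8 * (((n + 1) ! : ℕ) : ℝ) ^ 2 * 342 ^ n := by gcongr
      _ ≤ 8 * (((n + 1) ! : ℕ) : ℝ) ^ 2 * 342 ^ (n + 1) := by gcongr

/-- Monotonicity of the version-2 table. [cite: BenfattoGiulianiMastropietro2006, §2.2 (2.9)] -/
theorem klChi2CauchyTab2_mono : Monotone klChi2CauchyTab2 := monotone_nat_of_le_succ klChi2CauchyTab2_le_succ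

/-- **The FLAT table form, version 2**: `∀ i ≤ n, ∀ x, ‖Dⁱχ₂(x)‖ ≤ klChi2CauchyTab2 n`. [cite: BenfattoGiulianiMastropietro2006, §2.2 (2.9)] -/
theorem salmhoferCutoff_flat_cauchy_table2 (n : ℕ) :
    ∀ i ≤ n, ∀ x : ℝ, ‖iteratedFDeriv ℝ i salmhoferCutoff x‖ ≤ klChi2CauchyTab2 n :=
  fun i hi x => (norm_iteratedFDeriv_salmhoferCutoff_le_klChi2CauchyTab2 i x).trans (klChi2CauchyTab2_mono hi)

/-- The flat form in the `iteratedDeriv` currency of `…ScaleZeroCovarianceMomentumJets` (`hB`): `∀ i ≤ n, ∀ t, ‖iteratedDeriv i χ₂ t‖ ≤ klChi2CauchyTab2 n`.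
[cite: BenfattoGiulianiMastropietro2006, §2.2 (2.9)] -/
theorem salmhoferCutoff_flat_cauchy_table2_deriv (n : ℕ) :
    ∀ i ≤ n, ∀ t : ℝ, ‖iteratedDeriv i salmhoferCutoff t‖ ≤ klChi2CauchyTab2 n := by
  intro i hi t
  rw [← norm_iteratedFDeriv_eq_norm_iteratedDeriv]
  exact salmhoferCutoff_flat_cauchy_table2 n i hi t

end Summit.HubbardSuperconductivity.HubbardSuperconductivity.Theorems.KLRegimeSplit

end
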